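import Summits.QuantumFields.YangMills.Theorems.BalabanUVNodesN15CovariantAveragingSandwichRows
import Summits.QuantumFields.YangMills.Theorems.BalabanUVNodesN15SmallFieldAllLayersAdjointKnit
import HarnessLib

/-!
# N15 (NE2), PROGRAMME Q, part (Q-6c): THE KNITS OF (Q-3) ∕ (Q-4) ∕ (Q-5) ∕ (∂-2)§3 INSTANTIATED ON THE CONSTRUCTED COVARIANT AVERAGING — NO DISPLAYED ROW LEFT

dag-n15-a g31, KNIT-BY-NAME seat, node N15 = NE2. HONEST LABEL: by-name bookkeeping on MODEL carriers (dag-n15-c's two-spacing glued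
torus and `sfInstance`; Σ-F's ∕ (∂-1)'s operator layers; (Q-3)'s site kernel and (Q-4)'s Dirichlet unit kernel with the sandwich's block
averaging perturbed by a family `(D_c, E_c, D_f, E_f)`). NOT [B9] Thms 3.1 ∕ 3.2 ∕ 3.15 AS PRINTED: the averaging in the sandwich is
dag-n15-c's kernel-defined `Q_{T(A′)}` ([5] (124)–(125) shape) read through (Q-6a)'s family, the propagators are the model's. N15 stays
DISCHARGED OF RECORD 8∕28 AS CONSUMED on p687738; nothing here re-claims it; no count.

WHAT.  (Q-3) `ne2PlusSite_foSiteCov`, (Q-4) `ne2PlusUnit_foCovCovLam`, (Q-5) `exists_live_and_n15At_sfObjects₄covQLam` ∕ `s_N15_of_admits_sf₄covQLam`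
and (∂-2)§3 `live_and_n15At_sf₄adj_covQ_allLiveLam` are PARAMETRIC in a perturbation family with a displayed hypothesis `hfam` (six rows).
(Q-6b) `qvCov_rows_sf` proved `hfam` for the CONSTRUCTED family `(qDc, qEc, qDf, qEf)` = dag-n15-c's covariant block averaging of the
exponentiated field minus the flat one.  This file applies the five knits to it (`exact`), so that the road-(c) literals below carry the
site and unit layers with a COVARIANTLY averaged sandwich and NO displayed row:

* §1 `ne2PlusSite_foSiteCov_qv`, `ne2PlusUnit_foCovCovLam_qv` — the two layer templates of record (`T4EtaRate.NE2PlusSite ∕ NE2PlusUnit`);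
* §2 the closed literal `sfObjects₄qv` (:= (Q-5)'s `sfObjects₄covQLam` at the constructed family), `exists_live_and_n15At_sfObjects₄qv`, the pinned
  threshold `wQv`, ★★★ `live_and_n15At_sfObjects₄qv_wQv` (guard ∧ `N15At`), the keyed face `s_N15_of_admits_sf₄qv`;
* §3 the adjoint-arrangement twin `live_and_n15At_sf₄adj_qv_allLiveLam` ((∂-2)§3 at the constructed family);
* §4 ★★ `live_and_n15At_op_qv_allLiveLam` — GENERIC in the operator layer (`Kop`, `NE2PlusOperator … Kop` by name): the socket for dag-n15-c's
  189b `ne2PlusOperator_sfq` (covariant summand live in entry 0), a one-line instantiation when it lands.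

References: [5] T. Balaban, CMP 98 (1985) 17–51, (124)–(126) p.36; [B9] T. Balaban, CMP 99 (1985) 389–434, (3.42) p.397, (3.80)–(3.81) p.406.
-/

noncomputable section

open scoped BigOperators Matrix

namespace Summit.QuantumFields.YangMills.BalabanUVNodes.N15.SiteLayerSf

open Literature.MathematicalPhysics.QuantumFieldTheory.Balaban1983to89
open Literature.MathematicalPhysics.QuantumFieldTheory.Balaban1983to89.T4EtaRate (NE2PlusOperator NE2PlusSite NE2PlusUnit)
open Literature.Barriers.QuantumFields (traceForm)
open Summit.QuantumFields.YangMills.BalabanUVNodes.N15.Gluing (SfIdx sfInstance sfFamily CvX CvX' cvM)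
open Summit.QuantumFields.YangMills.BalabanUVNodes.N15.GenuineRecord (sfE₄cov sfE₄adj)
open Summit.QuantumFields.YangMills.BalabanUVNodes.N15.PairedFamilyGuard (Live)
open Literature.MathematicalPhysics.QuantumFieldTheory.Balaban1983to89.T4Continuum (T4Family ULoop)
open Node00 (NE2Objects₁₁)
open Summit.QuantumFields.YangMills.BalabanUVNodes.N15.AtKeyedHome (s_N15_of_admits)
open YMDAG.UVSplit (Datum RateCarriers RateRecordPred N15At S_N15 ne2OfRecord₁₁)

variable (d : ℕ) {L : ℕ} [NeZero L] (mm ι : Type) [Fintype mm] [DecidableEq mm] [Fintype ι] [DecidableEq ι] (a : ℝ) (e : Matrix mm mm ℂ ≃L[ℝ] (ι → ℝ))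

/-! ## §1 The two layer templates of record at the constructed family -/

section Layers

variable [Nonempty mm]

/-- ★★ **`NE2PlusSite` FOR dag-n15-c's CLASS WITH THE COVARIANTLY AVERAGED SITE KERNEL** — (Q-3)'s `ne2PlusSite_foSiteCov` at the constructed family `(qDc, qEc, qDf, qEf)`, its
displayed `hfam` DISCHARGED by (Q-6b)'s `qvCov_rows_sf`; no displayed row remains (odd `L ≥ 7`, `a, c₃₅ > 0`, trace-form-orthonormal `e`, `ι` nonempty).
[cite: Balaban1985BackgroundPropagators, Thm 3.2 (3.47) p.398 with (3.80)–(3.81) p.406 (shape: MODEL level)] -/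
theorem ne2PlusSite_foSiteCov_qv [Nonempty ι] (hL : Odd L ∧ 1 < L) (hL7 : 7 ≤ L) (ha : 0 < a) {c35 : ℝ} (hc35 : 0 < c35)
    (he : ∀ A B : Matrix mm mm ℂ, traceForm A B = e A ⬝ᵥ e B) (α β : Fin (d + 1)) (j j' : ι) (d' : ℕ) (p : ℝ) :
    NE2PlusSite d' p c35 (sfInstance d mm ι hL) (foSiteCov d mm ι a e hL α β j j' (qDc d mm ι e hL) (qEc d mm ι e hL) (qDf d mm ι e hL) (qEf d mm ι e hL)) :=
  ne2PlusSite_foSiteCov d mm ι a e hL hL7 ha hc35 he α β j j' d' p _ _ _ _ (qvCov_rows_sf d mm ι e hL hc35.le)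

/-- ★★ **`NE2PlusUnit` FOR dag-n15-c's CLASS WITH THE COVARIANTLY AVERAGED DIRICHLET UNIT KERNEL** above a size threshold `w` — (Q-4)'s `ne2PlusUnit_foCovCovLam` at the constructed
family, `hfam` DISCHARGED (`d ≥ 1`). [cite: Balaban1985BackgroundPropagators, Thm 3.1 (3.45) p.398 with (3.80)–(3.81) p.406 (shape: MODEL level)] -/
theorem ne2PlusUnit_foCovCovLam_qv [Nonempty ι] (hd : 1 ≤ d) (hL : Odd L ∧ 1 < L) (hL7 : 7 ≤ L) (ha : 0 < a) {c35 : ℝ} (hc35 : 0 < c35)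
    (he : ∀ A B : Matrix mm mm ℂ, traceForm A B = e A ⬝ᵥ e B) (α β : Fin (d + 1)) (j j' : ι) :
    ∃ w : ℝ, NE2PlusUnit c35 (fun i : SfIdxGE d L w × Finset (Fin (d + 1) → ℤ) => sfInstance d mm ι hL i.1.1)
      (fun i => foCovCovLam d mm ι a e hL α β j j' (qDc d mm ι e hL) (qEc d mm ι e hL) (qDf d mm ι e hL) (qEf d mm ι e hL) i.1.1 i.2)
      (fun i => inLamSf d mm ι hL i.1.1 i.2) (fun i => (sfInstance d mm ι hL i.1.1).gc.dist) :=
  ne2PlusUnit_foCovCovLam d mm ι a e hd hL hL7 ha hc35 he α β j j' _ _ _ _ (qvCov_rows_sf d mm ι e hL hc35.le)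

end Layers

/-! ## §2 The closed road-(c) literal with a covariantly averaged sandwich and no displayed row -/

section Literal

variable [Nonempty mm]

/-- **THE ROAD-(c) LITERAL WITH ALL THREE LAYERS U-LIVE, THE CONSTRUCTED COVARIANT AVERAGING IN THE SANDWICH AND A GENUINE DIRICHLET REGION** at a size threshold `w`:
(Q-5)'s `sfObjects₄covQLam` at the family `(qDc, qEc, qDf, qEf)` — a CLOSED literal: no parameter family, no displayed row. [bookkeeping] -/
def sfObjects₄qv (hL : Odd L ∧ 1 < L) (μ₁ μ₂ α β : Fin (d + 1)) (j j' : ι) (α' β' : Fin (d + 1)) (j₂ j₂' : ι) (c35 p w : ℝ) : NE2Objects₁₁ :=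
  sfObjects₄covQLam d mm ι a e hL μ₁ μ₂ α β j j' α' β' j₂ j₂' (qDc d mm ι e hL) (qEc d mm ι e hL) (qDf d mm ι e hL) (qEf d mm ι e hL) c35 p w

omit [Nonempty mm] in
/-- `sfObjects₄qv` is (Q-5)'s literal at the constructed family. [bookkeeping] -/
theorem sfObjects₄qv_eq (hL : Odd L ∧ 1 < L) (μ₁ μ₂ α β : Fin (d + 1)) (j j' : ι) (α' β' : Fin (d + 1)) (j₂ j₂' : ι) (c35 p w : ℝ) :
    sfObjects₄qv d mm ι a e hL μ₁ μ₂ α β j j' α' β' j₂ j₂' c35 p w =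
      sfObjects₄covQLam d mm ι a e hL μ₁ μ₂ α β j j' α' β' j₂ j₂' (qDc d mm ι e hL) (qEc d mm ι e hL) (qDf d mm ι e hL) (qEf d mm ι e hL) c35 p w := rfl

/-- ★★★ **GUARD ∧ `N15At` AT THE COVARIANTLY AVERAGED DIRICHLET ALL-LIVE LITERAL, SOME THRESHOLD** (`d ≥ 1`, odd `L ≥ 7`, `a, c₃₅ > 0`, trace-form-orthonormal `e`, `ι` nonempty):
(Q-5)'s `exists_live_and_n15At_sfObjects₄covQLam` with `hfam` DISCHARGED by (Q-6b). [cite: Balaban1985BackgroundPropagators, (3.42) p.397, Thms 3.1∕3.2 p.398 (shape: MODEL level)] -/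
theorem exists_live_and_n15At_sfObjects₄qv [Nonempty ι] (hd : 1 ≤ d) (hL : Odd L ∧ 1 < L) (hL7 : 7 ≤ L) (ha : 0 < a) {c35 : ℝ} (hc35 : 0 < c35)
    (he : ∀ A B : Matrix mm mm ℂ, traceForm A B = e A ⬝ᵥ e B) (μ₁ μ₂ α β : Fin (d + 1)) (j j' : ι) (α' β' : Fin (d + 1)) (j₂ j₂' : ι) (p : ℝ) :
    ∃ w : ℝ, Live (ne2OfRecord₁₁ (sfObjects₄qv d mm ι a e hL μ₁ μ₂ α β j j' α' β' j₂ j₂' c35 p w)) ∧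
      N15At (ne2OfRecord₁₁ (sfObjects₄qv d mm ι a e hL μ₁ μ₂ α β j j' α' β' j₂ j₂' c35 p w)) :=
  exists_live_and_n15At_sfObjects₄covQLam d mm ι a e hd hL hL7 ha hc35 he μ₁ μ₂ α β j j' α' β' j₂ j₂' p _ _ _ _ (qvCov_rows_sf d mm ι e hL hc35.le)

/-- **THE PINNED THRESHOLD** `w_qv` (a `Classical.choose` — NON-EXPLICIT cube floor). [bookkeeping] -/
def wQv [Nonempty ι] (hd : 1 ≤ d) (hL : Odd L ∧ 1 < L) (hL7 : 7 ≤ L) (ha : 0 < a) {c35 : ℝ} (hc35 : 0 < c35) (he : ∀ A B : Matrix mm mm ℂ, traceForm A B = e A ⬝ᵥ e B)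
    (μ₁ μ₂ α β : Fin (d + 1)) (j j' : ι) (α' β' : Fin (d + 1)) (j₂ j₂' : ι) (p : ℝ) : ℝ :=
  Classical.choose (exists_live_and_n15At_sfObjects₄qv d mm ι a e hd hL hL7 ha hc35 he μ₁ μ₂ α β j j' α' β' j₂ j₂' p)

/-- ★★★ **GUARD ∧ `N15At` AT THE COVARIANTLY AVERAGED DIRICHLET ALL-LIVE LITERAL PINNED AT `w_qv`** — a CLOSED literal: no U-blind layer, no `⊤` region, no flat averaging forced in
the sandwich, NO displayed row and NO parameter family. [cite: Balaban1985BackgroundPropagators, (3.42) p.397, Thms 3.1∕3.2 p.398 (shape: MODEL level)] -/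
theorem live_and_n15At_sfObjects₄qv_wQv [Nonempty ι] (hd : 1 ≤ d) (hL : Odd L ∧ 1 < L) (hL7 : 7 ≤ L) (ha : 0 < a) {c35 : ℝ} (hc35 : 0 < c35)
    (he : ∀ A B : Matrix mm mm ℂ, traceForm A B = e A ⬝ᵥ e B) (μ₁ μ₂ α β : Fin (d + 1)) (j j' : ι) (α' β' : Fin (d + 1)) (j₂ j₂' : ι) (p : ℝ) :
    Live (ne2OfRecord₁₁ (sfObjects₄qv d mm ι a e hL μ₁ μ₂ α β j j' α' β' j₂ j₂' c35 p
        (wQv d mm ι a e hd hL hL7 ha hc35 he μ₁ μ₂ α β j j' α' β' j₂ j₂' p))) ∧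
      N15At (ne2OfRecord₁₁ (sfObjects₄qv d mm ι a e hL μ₁ μ₂ α β j j' α' β' j₂ j₂' c35 p
        (wQv d mm ι a e hd hL hL7 ha hc35 he μ₁ μ₂ α β j j' α' β' j₂ j₂' p))) :=
  Classical.choose_spec (exists_live_and_n15At_sfObjects₄qv d mm ι a e hd hL hL7 ha hc35 he μ₁ μ₂ α β j j' α' β' j₂ j₂' p)

variable {N : ℕ} [NeZero N] {key : (F : T4Family) → Datum F N → Prop}

/-- ★★ **THE COVARIANTLY AVERAGED DIRICHLET ALL-LIVE LITERAL AT ANY KEYED HOME** (part 30's interface): a rate home over ANY key admitting only the literals of a key-indexed NE2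
reading whose value everywhere is the pinned closed literal has `S_N15 RRec`. [bookkeeping] -/
theorem s_N15_of_admits_sf₄qv [Nonempty ι] (hd : 1 ≤ d) (hL : Odd L ∧ 1 < L) (hL7 : 7 ≤ L) (ha : 0 < a) {c35 : ℝ} (hc35 : 0 < c35)
    (he : ∀ A B : Matrix mm mm ℂ, traceForm A B = e A ⬝ᵥ e B) (μ₁ μ₂ α β : Fin (d + 1)) (j j' : ι) (α' β' : Fin (d + 1)) (j₂ j₂' : ι) (p : ℝ)
    (ne2At : ∀ {F : T4Family} {D : Datum F N}, key F D → (ℕ → ℝ) → List (ULoop F) → ℕ → NE2Objects₁₁) (RRec : RateRecordPred N)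
    (hadm : ∀ (F : T4Family) (D : Datum F N) (g₀ : ℕ → ℝ) (os : List (ULoop F)) (R : RateCarriers N), RRec F D g₀ os R →
      ∃ (h : key F D) (k : ℕ), R.ne2 = ne2OfRecord₁₁ (ne2At h g₀ os k))
    (h : ∀ (F : T4Family) (D : Datum F N) (h : key F D) (g₀ : ℕ → ℝ) (os : List (ULoop F)) (k : ℕ),
      ne2At h g₀ os k = sfObjects₄qv d mm ι a e hL μ₁ μ₂ α β j j' α' β' j₂ j₂' c35 p (wQv d mm ι a e hd hL hL7 ha hc35 he μ₁ μ₂ α β j j' α' β' j₂ j₂' p)) :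
    S_N15 RRec :=
  s_N15_of_admits ne2At RRec hadm fun F D hk g₀ os k => by
    rw [h F D hk g₀ os k]
    exact (live_and_n15At_sfObjects₄qv_wQv d mm ι a e hd hL hL7 ha hc35 he μ₁ μ₂ α β j j' α' β' j₂ j₂' p).2

end Literal

/-! ## §3 The adjoint-arrangement twin -/

section Adjoint

variable [Nonempty mm]

/-- ★★ **GUARD ∧ `N15At` WITH (∂-1)'s ADJOINT-ARRANGEMENT OPERATOR LAYER, THE CONSTRUCTED COVARIANT AVERAGING IN THE SANDWICH AND A GENUINE DIRICHLET REGION**, some threshold: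
(∂-2)§3's `live_and_n15At_sf₄adj_covQ_allLiveLam` at the family `(qDc, qEc, qDf, qEf)`, `hfam` DISCHARGED. [cite: Balaban1985BackgroundPropagators, (3.42) p.397 (`𝒢∘∇*_U` entry), Thms 3.1∕3.2 p.398 (shape)] -/
theorem live_and_n15At_sf₄adj_qv_allLiveLam [Nonempty ι] (hd : 1 ≤ d) (hL : Odd L ∧ 1 < L) (hL7 : 7 ≤ L) (ha : 0 < a) {c35 : ℝ} (hc35 : 0 < c35)
    (he : ∀ A B : Matrix mm mm ℂ, traceForm A B = e A ⬝ᵥ e B) (μ₁ μ₂ α β : Fin (d + 1)) (j j' : ι) (α' β' : Fin (d + 1)) (j₂ j₂' : ι) (p : ℝ) :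
    ∃ w : ℝ,
      Live ⟨SfIdxGE d L w × RegIdx0 d, c35, p, fun x => sfInstance d mm ι hL x.1.1, fun x => sfFamily d mm ι a e hL x.1.1 (sfE₄adj d mm ι a e hL μ₁ μ₂ x.1.1),
          fun x => foSiteCov d mm ι a e hL α β j j' (qDc d mm ι e hL) (qEc d mm ι e hL) (qDf d mm ι e hL) (qEf d mm ι e hL) x.1.1,
          fun x => foCovCovLam d mm ι a e hL α' β' j₂ j₂' (qDc d mm ι e hL) (qEc d mm ι e hL) (qDf d mm ι e hL) (qEf d mm ι e hL) x.1.1 x.2.1, fun x => inLamSf d mm ι hL x.1.1 x.2.1,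
          fun x => (sfInstance d mm ι hL x.1.1).gc.dist⟩ ∧
      N15At { I := SfIdxGE d L w × RegIdx0 d, c35 := c35, p := p, pi := fun x => sfInstance d mm ι hL x.1.1,
              Kop := fun x => sfFamily d mm ι a e hL x.1.1 (sfE₄adj d mm ι a e hL μ₁ μ₂ x.1.1),
              Ksite := fun x => foSiteCov d mm ι a e hL α β j j' (qDc d mm ι e hL) (qEc d mm ι e hL) (qDf d mm ι e hL) (qEf d mm ι e hL) x.1.1,
              Kunit := fun x => foCovCovLam d mm ι a e hL α' β' j₂ j₂' (qDc d mm ι e hL) (qEc d mm ι e hL) (qDf d mm ι e hL) (qEf d mm ι e hL) x.1.1 x.2.1,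
              inΛ := fun x => inLamSf d mm ι hL x.1.1 x.2.1, unitDist := fun x => (sfInstance d mm ι hL x.1.1).gc.dist } :=
  live_and_n15At_sf₄adj_covQ_allLiveLam d mm ι a e hd hL hL7 ha hc35 he μ₁ μ₂ α β j j' α' β' j₂ j₂' p _ _ _ _ (qvCov_rows_sf d mm ι e hL hc35.le)

end Adjoint

/-! ## §4 Generic in the operator layer: the socket for dag-n15-c's covariant operator layer -/

section OpSocket

variable [Nonempty mm]

/-- ★★ **THE COVARIANTLY AVERAGED LITERAL WITH ANY OPERATOR LAYER SATISFYING `NE2PlusOperator` BY NAME** (the socket for dag-n15-c's 189b `ne2PlusOperator_sfq`, operator layer with the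
covariant-averaging summand LIVE in entry 0 of (3.42), once it lands): for every operator-layer family `Kop` over dag-n15-c's class with `NE2PlusOperator c₃₅ (sfInstance …) Kop`, the
literal «`Kop`, (Q-3)'s site kernel and (Q-4)'s Dirichlet unit kernel at the CONSTRUCTED covariant averaging, genuine region `inLamSf`» on `SfIdxGE d L w × RegIdx0 d` has the K3⁸ guard
and `N15At` at some threshold `w` (`d ≥ 1`, odd `L ≥ 7`, `a, c₃₅ > 0`, trace-form-orthonormal `e`, `ι` nonempty). One-line instantiation: `… Kop hop`. [bookkeeping] -/
theorem live_and_n15At_op_qv_allLiveLam [Nonempty ι] (hd : 1 ≤ d) (hL : Odd L ∧ 1 < L) (hL7 : 7 ≤ L) (ha : 0 < a) {c35 : ℝ} (hc35 : 0 < c35)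
    (he : ∀ A B : Matrix mm mm ℂ, traceForm A B = e A ⬝ᵥ e B) (α β : Fin (d + 1)) (j j' : ι) (α' β' : Fin (d + 1)) (j₂ j₂' : ι) (p : ℝ)
    (Kop : ∀ i : SfIdx d L, B9.KernelFamily (sfInstance d mm ι hL i).gc (sfInstance d mm ι hL i).Bf) (hop : NE2PlusOperator c35 (sfInstance d mm ι hL) Kop) :
    ∃ w : ℝ,
      Live ⟨SfIdxGE d L w × RegIdx0 d, c35, p, fun x => sfInstance d mm ι hL x.1.1, fun x => Kop x.1.1,
          fun x => foSiteCov d mm ι a e hL α β j j' (qDc d mm ι e hL) (qEc d mm ι e hL) (qDf d mm ι e hL) (qEf d mm ι e hL) x.1.1,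
          fun x => foCovCovLam d mm ι a e hL α' β' j₂ j₂' (qDc d mm ι e hL) (qEc d mm ι e hL) (qDf d mm ι e hL) (qEf d mm ι e hL) x.1.1 x.2.1, fun x => inLamSf d mm ι hL x.1.1 x.2.1,
          fun x => (sfInstance d mm ι hL x.1.1).gc.dist⟩ ∧
      N15At { I := SfIdxGE d L w × RegIdx0 d, c35 := c35, p := p, pi := fun x => sfInstance d mm ι hL x.1.1, Kop := fun x => Kop x.1.1,
              Ksite := fun x => foSiteCov d mm ι a e hL α β j j' (qDc d mm ι e hL) (qEc d mm ι e hL) (qDf d mm ι e hL) (qEf d mm ι e hL) x.1.1,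
              Kunit := fun x => foCovCovLam d mm ι a e hL α' β' j₂ j₂' (qDc d mm ι e hL) (qEc d mm ι e hL) (qDf d mm ι e hL) (qEf d mm ι e hL) x.1.1 x.2.1,
              inΛ := fun x => inLamSf d mm ι hL x.1.1 x.2.1, unitDist := fun x => (sfInstance d mm ι hL x.1.1).gc.dist } := by
  obtain ⟨w, hunit⟩ := ne2PlusUnit_foCovCovLam_qv d mm ι a e hd hL hL7 ha hc35 he α' β' j₂ j₂'
  exact ⟨w, live_sfGELam d mm ι hL w hc35.le p _ _ _,
    ⟨ne2PlusOperator_comp (fun x : SfIdxGE d L w × RegIdx0 d => x.1.1) hop,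
      ne2PlusSite_comp (fun x : SfIdxGE d L w × RegIdx0 d => x.1.1) (ne2PlusSite_foSiteCov_qv d mm ι a e hL hL7 ha hc35 he α β j j' 4 p),
      ne2PlusUnit_comp (fun x : SfIdxGE d L w × RegIdx0 d => ((x.1, x.2.1) : SfIdxGE d L w × Finset (Fin (d + 1) → ℤ))) hunit⟩⟩

end OpSocket

end Summit.QuantumFields.YangMills.BalabanUVNodes.N15.SiteLayerSf

end
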